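import Mathlib
import Summits.Parity.GeneralizedHardyLittlewood.Theses.LiouvilleShiftedTables

/-!
# Calibration of crux `TableChowla` (stmt-Parity-14270): it contains the fixed-residue
# level-of-distribution `1 − δ` statement for `λ` (ℓ¹ over moduli, absolute values)

`tableChowla_fixedResidueFace`: from the crux (fourth moment of the `q = 1` shifted
multiplication table `≤ x²/(log x)^C` for every `C`) two Cauchy–Schwarz steps give
`Σ_{b ≤ x/A} |Σ_{a ∈ (A,2A]} λ(ab+c)| ≤ x/(log x)^C` for every `C`, uniformly for
`A ∈ [x^δ, x^{1/3+δ}]`.  With `A = x^δ` the moduli `b` run up to `x^{1−δ}` and each inner sum is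
`λ` over the progression `{n ≡ c (mod b)} ∩ (Ab, 2Ab]` (`x^δ` terms at height `≍ bx^δ`): an
Elliott–Halberstam-type statement for the Liouville function with FIXED residue `c`, absolute
values over the moduli, at level `1 − δ` — beyond GRH (level `1/2`) and beyond every dispersion
record.  (Planner calibration, crux-ideate round 1, ideator 3.)
-/

namespace Summit.Parity.GeneralizedHardyLittlewood.Cruxes.TableChowla.Calibration

open Summit.Parity.GeneralizedHardyLittlewood.Theses.LiouvilleShiftedTables
open Finset

/-- Abstract heart: for any real array `u a b` on `I × J`, if the fourth moment
`Σ_{a,a' ∈ I} (Σ_{b ∈ J} u a b · u a' b)² ≤ E` then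
`(Σ_{b ∈ J} |Σ_{a ∈ I} u a b|)² ≤ |J| · |I| · √E` (two Cauchy–Schwarz steps). -/
theorem sq_sum_abs_le_of_fourthMoment {I J : Finset ℕ} (u : ℕ → ℕ → ℝ) {E : ℝ}
    (hE : ∑ a ∈ I, ∑ a' ∈ I, (∑ b ∈ J, u a b * u a' b) ^ 2 ≤ E) :
    (∑ b ∈ J, |∑ a ∈ I, u a b|) ^ 2 ≤ (J.card : ℝ) * I.card * Real.sqrt E := by
  -- Step 1: Cauchy–Schwarz over `b`.
  have h1 : (∑ b ∈ J, |∑ a ∈ I, u a b|) ^ 2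
      ≤ (J.card : ℝ) * ∑ b ∈ J, (∑ a ∈ I, u a b) ^ 2 := by
    have := sum_mul_sq_le_sq_mul_sq J (fun _ => (1 : ℝ)) (fun b => |∑ a ∈ I, u a b|)
    simpa [sq_abs] using this
  -- Step 2: expand the square: `Σ_b (Σ_a u a b)² = Σ_a Σ_a' Σ_b u a b · u a' b`.
  have h2 : ∑ b ∈ J, (∑ a ∈ I, u a b) ^ 2 = ∑ a ∈ I, ∑ a' ∈ I, ∑ b ∈ J, u a b * u a' b := by
    have : ∀ b, (∑ a ∈ I, u a b) ^ 2 = ∑ a ∈ I, ∑ a' ∈ I, u a b * u a' b := by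
      intro b
      rw [sq, sum_mul_sum]
    simp_rw [this]
    rw [sum_comm]
    refine sum_congr rfl fun a _ => ?_
    rw [sum_comm]
  -- Step 3: Cauchy–Schwarz over the pairs `(a,a')`.
  have h3 : (∑ a ∈ I, ∑ a' ∈ I, ∑ b ∈ J, u a b * u a' b) ^ 2
      ≤ ((I.card : ℝ) * I.card) * ∑ a ∈ I, ∑ a' ∈ I, (∑ b ∈ J, u a b * u a' b) ^ 2 := by
    have hcs := sum_mul_sq_le_sq_mul_sq (I ×ˢ I) (fun _ => (1 : ℝ))
      (fun p => ∑ b ∈ J, u p.1 b * u p.2 b)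
    have e1 : ∑ p ∈ I ×ˢ I, (1 : ℝ) * ∑ b ∈ J, u p.1 b * u p.2 b
        = ∑ a ∈ I, ∑ a' ∈ I, ∑ b ∈ J, u a b * u a' b := by
      rw [sum_product]
      simp
    have e2 : ∑ p ∈ I ×ˢ I, (∑ b ∈ J, u p.1 b * u p.2 b) ^ 2
        = ∑ a ∈ I, ∑ a' ∈ I, (∑ b ∈ J, u a b * u a' b) ^ 2 := by
      rw [sum_product]
    have e3 : ∑ p ∈ I ×ˢ I, ((1 : ℝ)) ^ 2 = (I.card : ℝ) * I.card := by
      simp [card_product]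
    rw [e1, e2, e3] at hcs
    exact hcs
  -- Step 4: hence `Σ_a Σ_a' S ≤ |I| √E`.
  have hE0 : 0 ≤ E := le_trans (sum_nonneg fun a _ => sum_nonneg fun a' _ => sq_nonneg _) hE
  have h4 : ∑ a ∈ I, ∑ a' ∈ I, ∑ b ∈ J, u a b * u a' b ≤ (I.card : ℝ) * Real.sqrt E := by
    have hsq : (∑ a ∈ I, ∑ a' ∈ I, ∑ b ∈ J, u a b * u a' b) ^ 2
        ≤ ((I.card : ℝ) * Real.sqrt E) ^ 2 := by
      calc (∑ a ∈ I, ∑ a' ∈ I, ∑ b ∈ J, u a b * u a' b) ^ 2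
          ≤ ((I.card : ℝ) * I.card) * ∑ a ∈ I, ∑ a' ∈ I, (∑ b ∈ J, u a b * u a' b) ^ 2 := h3
        _ ≤ ((I.card : ℝ) * I.card) * E := by
            exact mul_le_mul_of_nonneg_left hE (by positivity)
        _ = ((I.card : ℝ) * Real.sqrt E) ^ 2 := by
            rw [mul_pow, Real.sq_sqrt hE0]; ring
    exact (abs_le_of_sq_le_sq' hsq (by positivity)).2
  -- Combine.
  calc (∑ b ∈ J, |∑ a ∈ I, u a b|) ^ 2
      ≤ (J.card : ℝ) * ∑ b ∈ J, (∑ a ∈ I, u a b) ^ 2 := h1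
    _ = (J.card : ℝ) * ∑ a ∈ I, ∑ a' ∈ I, ∑ b ∈ J, u a b * u a' b := by rw [h2]
    _ ≤ (J.card : ℝ) * ((I.card : ℝ) * Real.sqrt E) :=
        mul_le_mul_of_nonneg_left h4 (by positivity)
    _ = (J.card : ℝ) * I.card * Real.sqrt E := by ring

/-- **Calibration theorem.** `TableChowla` implies the fixed-residue ℓ¹ level-of-distribution
face: `∀ c ≠ 0, δ ∈ (0,1/12], C > 0`, for large `x` and all `A ∈ [x^δ, x^{1/3+δ}]`,
`Σ_{b ≤ x/A} |Σ_{a ∈ (A,2A]} λ(ab+c)| ≤ x/(log x)^C`. -/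
theorem tableChowla_fixedResidueFace (hT : TableChowla) :
    ∀ c : ℤ, c ≠ 0 → ∀ δ : ℝ, 0 < δ → δ ≤ 1 / 12 → ∀ C : ℝ, 0 < C → ∃ x₀ : ℝ, ∀ x : ℝ, x₀ ≤ x →
      ∀ A : ℝ, x ^ δ ≤ A → A ≤ x ^ (1 / 3 + δ) →
        (∑ b ∈ Icc 1 ⌊x / A⌋₊, |∑ a ∈ Ioc ⌊A⌋₊ ⌊2 * A⌋₊,
            (ArithmeticFunction.liouville (Int.toNat ((a : ℤ) * b + c)) : ℝ)|)
          ≤ x / Real.log x ^ C := by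
  intro c hc δ hδ hδ' C hC
  obtain ⟨x₀, hx₀⟩ := hT c hc δ hδ hδ' (4 * C + 4) (by linarith)
  refine ⟨max x₀ (Real.exp 2), fun x hx A hA1 hA2 => ?_⟩
  have hxx₀ : x₀ ≤ x := le_trans (le_max_left _ _) hx
  have hxe : Real.exp 2 ≤ x := le_trans (le_max_right _ _) hx
  have hx0 : 0 < x := lt_of_lt_of_le (Real.exp_pos 2) hxe
  have hx1 : 1 ≤ x := le_trans (Real.one_le_exp (by norm_num : (0:ℝ) ≤ 2)) hxe
  have hlog : 2 ≤ Real.log x := by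
    have := Real.log_le_log (Real.exp_pos 2) hxe
    simpa using this
  have hL0 : 0 < Real.log x := by linarith
  have hA1' : 1 ≤ A := le_trans (Real.one_le_rpow hx1 hδ.le) hA1
  have hA0 : 0 < A := by linarith
  specialize hx₀ x hxx₀ A hA1 hA2
  -- the abstract inequality
  set I : Finset ℕ := Ioc ⌊A⌋₊ ⌊2 * A⌋₊ with hI
  set J : Finset ℕ := Icc 1 ⌊x / A⌋₊ with hJ
  set L : ℝ := Real.log x with hL
  have key := sq_sum_abs_le_of_fourthMoment (I := I) (J := J)
    (fun a b => (ArithmeticFunction.liouville (Int.toNat ((a : ℤ) * b + c)) : ℝ)) hx₀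
  -- card bounds
  have hJcard : (J.card : ℝ) ≤ x / A := by
    have : J.card = ⌊x / A⌋₊ := by simp [hJ]
    rw [this]
    exact Nat.floor_le (by positivity)
  have hIcard : (I.card : ℝ) ≤ 2 * A := by
    have hc' : I.card = ⌊2 * A⌋₊ - ⌊A⌋₊ := by simp [hI]
    have hmono : ⌊A⌋₊ ≤ ⌊2 * A⌋₊ := Nat.floor_le_floor (by linarith)
    rw [hc', Nat.cast_sub hmono]
    have h2A : (⌊2 * A⌋₊ : ℝ) ≤ 2 * A := Nat.floor_le (by linarith)
    have hA' : A < (⌊A⌋₊ : ℝ) + 1 := Nat.lt_floor_add_one A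
    linarith
  -- √E
  have hsqrt : Real.sqrt (x ^ 2 / L ^ (4 * C + 4)) = x / L ^ (2 * C + 2) := by
    have hpow : L ^ (4 * C + 4) = (L ^ (2 * C + 2)) ^ 2 := by
      rw [← Real.rpow_natCast (L ^ (2 * C + 2)) 2, ← Real.rpow_mul hL0.le]
      congr 1
      push_cast
      ring
    rw [hpow, ← div_pow, Real.sqrt_sq]
    positivity
  rw [hsqrt] at key
  -- compare with the target
  have hmain : (∑ b ∈ J, |∑ a ∈ I,
      (ArithmeticFunction.liouville (Int.toNat ((a : ℤ) * b + c)) : ℝ)|) ^ 2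
        ≤ (x / L ^ C) ^ 2 := by
    refine le_trans key ?_
    have hsplit : L ^ (2 * C + 2) = L ^ (2 * C) * L ^ (2 : ℝ) := by
      rw [← Real.rpow_add hL0]
    have hLC : (L ^ C) ^ 2 = L ^ (2 * C) := by
      rw [← Real.rpow_natCast (L ^ C) 2, ← Real.rpow_mul hL0.le]
      congr 1
      push_cast
      ring
    have hL2 : L ^ (2 : ℝ) = L ^ (2 : ℕ) := by
      rw [← Real.rpow_natCast]
      norm_num
    have hpos2C : 0 < L ^ (2 * C) := Real.rpow_pos_of_pos hL0 _
    calc (J.card : ℝ) * I.card * (x / L ^ (2 * C + 2))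
        ≤ (x / A) * (2 * A) * (x / L ^ (2 * C + 2)) := by
          apply mul_le_mul (mul_le_mul hJcard hIcard (by positivity) (by positivity)) le_rfl
            (by positivity) (by positivity)
      _ = 2 * x ^ 2 / (L ^ (2 * C) * L ^ (2 : ℕ)) := by
          rw [hsplit, hL2]; field_simp
      _ ≤ x ^ 2 / L ^ (2 * C) := by
          rw [div_le_div_iff₀ (by positivity) hpos2C]
          have h4 : (4 : ℝ) ≤ L ^ (2 : ℕ) := by nlinarith
          have hP : 0 ≤ x ^ 2 * L ^ (2 * C) := by positivity
          have h5 := mul_le_mul_of_nonneg_left h4 hP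
          nlinarith [h5, hP]
      _ = (x / L ^ C) ^ 2 := by rw [div_pow, hLC]
  have hR : 0 ≤ x / L ^ C := by positivity
  have hfin := (abs_le_of_sq_le_sq' hmain hR).2
  simpa [hI, hJ, hL] using hfin

end Summit.Parity.GeneralizedHardyLittlewood.Cruxes.TableChowla.Calibration
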